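import Literature.Probability.Percolation.QuadLowestCrossingProofs
import HarnessLib

/-!
# The fresh closed arm for lattice-aligned quad pairs (Schramm–Smirnov Lemma 6.1 (2), wild quads)

Topic `Probability/Percolation`.  Support for the gluing theorem (Schramm–Smirnov 2011, Thm 1.5 /
Prop 4.1), whose proof applies the one-sided continuity lemma (Lemma 6.1) to quads with *wild*
sides (bays of the revealed set).  The tree's charted version of Lemma 6.1
(`QuadLowestCrossingProofs.lean`, `QuadCrossingContinuityCaseTwoTame.lean`) needs quantitative
control of the chart (`Frame.Calib`: inverse modulus at the mesh scale) and tameness of the quads,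
which wild quads do not have.  Here we isolate what is needed when both quads are
**lattice-aligned** at the percolation mesh — unions of closed cells of `δℤ²`, so that every lattice
edge whose open segment meets the quad lies entirely in it (`EdgeAligned`): then

* `Frame.not_mem_openEdgeUnion_union_revealed_of_aligned` — the dual path of the larger quad, before
  it reaches the thin place, meets no revealed edge (no metric hypothesis at all: a revealed closed
  edge is joined inside its own open segment to the explored region, and that segment lies in the
  smaller quad by alignment; an edge poking below `∂₁` would have to leave the larger quad);
* `Frame.union_revealed_mem_annulusDualCrossing_of_aligned` — hence a closed dual crossing of the
  annulus `A(x; 4ρ₀, R)` about the endpoint `x` of the lowest crossing, off the revealed edges,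
  whenever the chart moves gap-segment points by at most `2ρ₀` (a modulus of the chart at the scale
  `Δ`, which may depend on the quad) and `x` is at distance `> R + 2δ` from the top side;
* `Frame.measure_inter_le_of_aligned` — the decoupling over the finitely many values of the explored
  region: `P(⊞_{Q'} ∖ ⊞_Q, x far from ∂₃) ≤ sup_x P(A(x; 4ρ₀, R) has a closed dual crossing)`.

Everything else (explored region, lowest crossing, endpoint, thin place, determination by the
revealed edges) is the tree's `QuadDualExploration` / `QuadLowestCrossingProofs`, used verbatim.

## References

* O. Schramm, S. Smirnov, *On the scaling limits of planar percolation*, Ann. Probab. 39 (2011)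
  1768–1814, arXiv:1101.5820, proof of Lemma 6.1 (pp. 22–23) and proof of Thm 1.5 (pp. 17–21).
  [SchrammSmirnov2011]
* G. Grimmett, *Percolation*, 2nd ed. (1999), §11.7–11.8 (RSW). [GrimmettPercolation1999]
-/

noncomputable section

open Set Metric Filter Function
open _root_.MeasureTheory _root_.Topology
open scoped ENNReal
open Literature.Probability.LatticeModels

namespace Literature.Probability.Percolation

namespace SSContinuity

/-- **Lattice-aligned sets**: every lattice edge of `δℤ²` whose *open* segment meets `S` has its
whole closed segment inside `S`.  Unions of closed mesh cells are aligned; for them an edge segment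
meets the set in the whole segment or in a subset of its two endpoints ("slits").
[cite: SchrammSmirnov2011, proof of Thm 1.5 (lattice domains)] -/
def EdgeAligned (δ : ℝ) (S : Set ℂ) : Prop :=
  ∀ a b : Site 2, (zdGraph 2).Adj a b →
    (openSegment ℝ (meshPoint δ a) (meshPoint δ b) ∩ S).Nonempty →
      segment ℝ (meshPoint δ a) (meshPoint δ b) ⊆ S

namespace Frame

variable (Φ : Frame)

/-- Points of `R'' ∖ R'` lie strictly below `im = c`, hence outside the wide rectangle. [folklore] -/
theorem not_mem_wideRect_of_mem_extRect_diff {u : ℂ} (hu : u ∈ Φ.extRect) (hu' : u ∉ Φ.rect) :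
    u ∉ Φ.wideRect := by
  intro hw
  apply hu'
  exact ⟨hu.1, ⟨hw.2.1, hu.2.2⟩⟩

variable {Φ}

/-- **The witness is unrevealed (aligned quads).**  If `G(R')` and `G(R)` are lattice-aligned, a
point `β s` of the dual path before the gap time lies on no open edge of `ω ∪ revealed Λ`: it is not
drawn, and a closed revealed edge through `G(β s)` would join `β s` to the explored region inside
its own open segment (which lies in `G(R')` by alignment, the revealing point being in `R'`; a
revealing point below `R'` would put a point outside `G(R)` on a segment meeting `G(R)`).
[cite: SchrammSmirnov2011, proof of Lemma 6.1] -/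
theorem not_mem_openEdgeUnion_union_revealed_of_aligned
    (hAl : EdgeAligned Φ.δ (Φ.G '' Φ.wideRect)) (hAl' : EdgeAligned Φ.δ (Φ.G '' Φ.rect))
    {ω : BondConfig (Site 2)} {β : ℝ → ℂ} (hβR : MapsTo β (Icc 0 1) Φ.wideRect)
    (hβO : ∀ t ∈ Icc (0 : ℝ) 1, Φ.G (β t) ∉ Φ.drawn ω) {tg : ℝ}
    (hbefore : ∀ s ∈ Icc (0 : ℝ) 1, s < tg → β s ∉ closure (Φ.explored ω) ∧ β s ∉ Φ.gapSeg ω Φ.Δ)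
    {s : ℝ} (hs : s ∈ Icc (0 : ℝ) 1) (hstg : s < tg) :
    Φ.G (β s) ∉ openEdgeUnion Φ.δ (ω ∪ Φ.revealed (Φ.explored ω)) := by
  intro hmem
  obtain ⟨x₀, y₀, hxy₀, hωu, hzseg₀⟩ := mem_openEdgeUnion_iff.1 hmem
  set z : ℂ := β s with hz
  have hzR : z ∈ Φ.wideRect := hβR hs
  have hzdrawn : Φ.G z ∉ Φ.drawn ω := hβO s hs
  have hclosed : s(x₀, y₀) ∉ ω := fun h =>
    hzdrawn (Or.inl (mem_openEdgeUnion_iff.2 ⟨x₀, y₀, hxy₀, h, hzseg₀⟩))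
  have hrev : s(x₀, y₀) ∈ Φ.revealed (Φ.explored ω) := hωu.resolve_left hclosed
  obtain ⟨x, y, hxy, hexy, m, hmcl, hmseg⟩ := hrev
  have hclosed' : s(x, y) ∉ ω := hexy ▸ hclosed
  set px : ℂ := meshPoint Φ.δ x with hpx
  set py : ℂ := meshPoint Φ.δ y with hpy
  have hzseg : Φ.G z ∈ segment ℝ px py := by
    rw [hpx, hpy, ← segment_eq_of_sym2_eq hexy (meshPoint Φ.δ)]; exact hzseg₀
  have hzV : Φ.G z ∉ range (meshPoint Φ.δ) := fun h => hzdrawn (Or.inr h)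
  have hzopen : Φ.G z ∈ openSegment ℝ px py := mem_openSegment_of_not_mem_range hzseg hzV
  have hmE : m ∈ Φ.extRect := Φ.closure_explored_subset_extRect ω hmcl
  -- the revealing point lies in `R'`
  have hmrect : m ∈ Φ.rect := by
    by_contra hmr
    have hmW : m ∉ Φ.wideRect := Φ.not_mem_wideRect_of_mem_extRect_diff hmE hmr
    have hne : (openSegment ℝ px py ∩ Φ.G '' Φ.wideRect).Nonempty := ⟨Φ.G z, hzopen, z, hzR, rfl⟩
    have hsub := hAl x y hxy hne
    obtain ⟨w, hw, hweq⟩ := hsub (openSegment_subset_segment ℝ _ _ hmseg)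
    exact hmW (by rwa [← Φ.G.injective hweq])
  -- the whole segment lies in `G(R')`
  have hne' : (openSegment ℝ px py ∩ Φ.G '' Φ.rect).Nonempty := ⟨Φ.G m, hmseg, m, hmrect, rfl⟩
  have hsegR : segment ℝ px py ⊆ Φ.G '' Φ.rect := hAl' x y hxy hne'
  -- the arc inside the open segment from `m` to `z`
  set P : ℝ → ℂ := fun t => Φ.G.symm (AffineMap.lineMap px py t) with hP
  have hPc : Continuous P := Φ.G.symm.continuous.comp AffineMap.lineMap_continuous
  obtain ⟨tz, htz, htzeq⟩ : ∃ t ∈ Ioo (0 : ℝ) 1, P t = z := by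
    rw [openSegment_eq_image_lineMap] at hzopen
    obtain ⟨t, ht, hteq⟩ := hzopen
    exact ⟨t, ht, by simp only [hP, hteq, Homeomorph.symm_apply_apply]⟩
  obtain ⟨tm, htm, htmeq⟩ : ∃ t ∈ Ioo (0 : ℝ) 1, P t = m := by
    rw [openSegment_eq_image_lineMap] at hmseg
    obtain ⟨t, ht, hteq⟩ := hmseg
    exact ⟨t, ht, by simp only [hP, hteq, Homeomorph.symm_apply_apply]⟩
  have hIoo_of_uIcc : ∀ {t : ℝ}, t ∈ uIcc tm tz → t ∈ Ioo (0 : ℝ) 1 := fun ht => by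
    rw [mem_uIcc] at ht
    rcases ht with ⟨h1, h2⟩ | ⟨h1, h2⟩
    · exact ⟨htm.1.trans_le h1, h2.trans_lt htz.2⟩
    · exact ⟨htz.1.trans_le h1, h2.trans_lt htm.2⟩
  have hPrect : ∀ t ∈ Icc (0 : ℝ) 1, P t ∈ Φ.rect := fun t ht => by
    have hq : AffineMap.lineMap px py t ∈ segment ℝ px py := by
      rw [segment_eq_image_lineMap]; exact ⟨t, ht, rfl⟩
    obtain ⟨w, hw, hweq⟩ := hsegR hq
    have : P t = w := by simp only [hP, ← hweq, Homeomorph.symm_apply_apply]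
    rwa [this]
  have hPobs : ∀ t ∈ Ioo (0 : ℝ) 1, P t ∉ Φ.obstacle ω := fun t ht => by
    have hop : AffineMap.lineMap px py t ∈ openSegment ℝ px py := by
      rw [openSegment_eq_image_lineMap]; exact ⟨t, ht, rfl⟩
    refine Φ.not_mem_obstacle_of_not_mem_drawn ?_
    simpa [hP, drawn] using not_mem_drawn_of_mem_openSegment Φ.hδ.ne' hxy hclosed' hop
  have hmΛ : m ∈ Φ.explored ω := Φ.mem_explored_of_mem_closure hmcl (htmeq ▸ hPobs tm htm)
  have hJ : JoinedIn (Φ.extRect \ Φ.obstacle ω) (P tm) (P tz) :=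
    joinedIn_of_forall_mem_uIcc hPc fun t ht =>
      ⟨Φ.rect_subset_extRect (hPrect t (Ioo_subset_Icc_self (hIoo_of_uIcc ht))),
        hPobs t (hIoo_of_uIcc ht)⟩
  rw [htmeq, htzeq] at hJ
  exact (hbefore s hs hstg).1 (subset_closure (Φ.mem_explored_of_joinedIn hmΛ hJ))

/-- **The fresh closed arm about the endpoint of the lowest crossing (aligned quads).**  Assume
`G(R')`, `G(R)` lattice-aligned, `G(R')` crossed and `G(R)` not crossed, the chart moving points of
`R₁⁺ = [a, b+Δ+1] × [c-η, d]` at distance `≤ Δ` by at most `2ρ₀` in the plane, `2δ ≤ ρ₀`,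
`4ρ₀ ≤ R`, and the endpoint `x = G(wallPt)` at plane distance `> R + 2δ` from the image of the top
side of `R`.  Then `ω ∪ revealed Λ` has a closed dual crossing of `A(x; 4ρ₀, R)`.
[cite: SchrammSmirnov2011, proof of Lemma 6.1, eq. (6.2)] -/
theorem union_revealed_mem_annulusDualCrossing_of_aligned
    (hAl : EdgeAligned Φ.δ (Φ.G '' Φ.wideRect)) (hAl' : EdgeAligned Φ.δ (Φ.G '' Φ.rect))
    {ρ₀ Rs : ℝ} (hδρ : 2 * Φ.δ ≤ ρ₀) (h4 : 4 * ρ₀ ≤ Rs)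
    (hmodG : ∀ u ∈ Φ.bigRect Φ.Δ, ∀ v ∈ Φ.bigRect Φ.Δ, dist u v ≤ Φ.Δ → dist (Φ.G u) (Φ.G v) ≤ 2 * ρ₀)
    {ω : BondConfig (Site 2)} (hcr : Φ.Crossed Φ.b ω) (hncr : ¬ Φ.Crossed (Φ.b + Φ.Δ) ω)
    (hfar : ∀ u ∈ Φ.wideRect, u.im = Φ.d → Rs + 2 * Φ.δ < dist (Φ.G u) (Φ.G (Φ.wallPt ω))) :
    ω ∪ Φ.revealed (Φ.explored ω) ∈
      annulusDualCrossing (Φ.G (Φ.wallPt ω)) Φ.δ (4 * ρ₀) Rs := by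
  obtain ⟨β, hβc, hβR, hβ0, hβ1, hβO⟩ := Φ.exists_dualPath hncr
  obtain ⟨tg, htgI, hgap, hbefore⟩ := Φ.exists_gapTime hcr hβc hβR hβ0 hβ1 hβO
  set x' : ℂ := Φ.wallPt ω with hx'
  set g : ℝ → ℝ := fun t => dist (Φ.G (β t)) (Φ.G x') with hg
  have hgc : ContinuousOn g (Icc 0 1) :=
    continuous_dist.comp_continuousOn ((Φ.G.continuous.comp_continuousOn hβc).prodMk continuousOn_const)
  have hx'E : x' ∈ Φ.extRect := Φ.wallPt_mem_extRect ω
  have hx'B : x' ∈ Φ.bigRect Φ.Δ := Φ.extRect_subset_bigRect Φ.hΔ.le hx'E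
  -- `g tg ≤ 2ρ₀`
  have hgtg : g tg ≤ 2 * ρ₀ := by
    have hd : dist (β tg) x' ≤ Φ.Δ := Φ.dist_wallPt_le_of_mem_gapSeg hgap
    exact hmodG _ (Φ.wideRect_subset_bigRect le_rfl (hβR htgI)) _ hx'B hd
  -- `g 0 > Rs + 2δ`
  have hg0 : Rs + 2 * Φ.δ < g 0 := hfar (β 0) (hβR ⟨le_rfl, zero_le_one⟩) hβ0
  have hρ : 0 < ρ₀ := by linarith [Φ.hδ]
  -- first entrance into the ball of radius `3ρ₀`
  obtain ⟨t₃, ht₃I, -, hgt₃, hbef₃⟩ := exists_first_le (g := g) (T := 1) (L := 3 * ρ₀) hgc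
    (by linarith [Φ.hδ.le]) ⟨tg, htgI, by linarith⟩
  have ht₃tg : t₃ < tg := by
    rcases lt_or_ge t₃ tg with h | h
    · exact h
    · rcases h.eq_or_lt with h' | h'
      · rw [← h'] at hgt₃; linarith
      · have := hbef₃ tg htgI h'; linarith
  -- last exit from the ball of radius `Rs + 2δ` before `t₃`
  obtain ⟨se, hseI, hset₃, hgse, haft⟩ := exists_last_ge (g := g) (T := t₃) (M := Rs + 2 * Φ.δ) ht₃I.1
    (hgc.mono (Icc_subset_Icc_right ht₃I.2)) hg0.le
    (by show g t₃ < Rs + 2 * Φ.δ; rw [hgt₃]; linarith [Φ.hδ])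
  -- the witness path, reversed: from `β t₃` to `β se`
  set W : ℝ → ℂ := fun u => Φ.G (β (AffineMap.lineMap t₃ se u)) with hW
  have hparam : ∀ u ∈ Icc (0 : ℝ) 1, AffineMap.lineMap t₃ se u ∈ Icc se t₃ := fun u hu => by
    have : AffineMap.lineMap t₃ se u ∈ segment ℝ t₃ se := by
      rw [segment_eq_image_lineMap]; exact ⟨u, hu, rfl⟩
    rw [segment_symm, segment_eq_Icc hset₃.le] at this
    exact this
  have hparamI : ∀ u ∈ Icc (0 : ℝ) 1, AffineMap.lineMap t₃ se u ∈ Icc (0 : ℝ) 1 := fun u hu =>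
    ⟨hseI.1.trans (hparam u hu).1, (hparam u hu).2.trans ht₃I.2⟩
  have hWc : ContinuousOn W (Icc 0 1) :=
    Φ.G.continuous.comp_continuousOn ((hβc.comp AffineMap.lineMap_continuous.continuousOn hparamI))
  have hgbound : ∀ s' ∈ Icc se t₃, 3 * ρ₀ ≤ g s' ∧ g s' ≤ Rs + 2 * Φ.δ := fun s' hs' => by
    have hs'I : s' ∈ Icc (0 : ℝ) 1 := ⟨hseI.1.trans hs'.1, hs'.2.trans ht₃I.2⟩
    refine ⟨?_, ?_⟩
    · rcases hs'.2.eq_or_lt with h | h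
      · rw [h, hgt₃]
      · exact (hbef₃ s' hs'I h).le
    · rcases hs'.1.eq_or_lt with h | h
      · rw [← h, hgse]
      · exact (haft s' ⟨hs'I.1, hs'.2⟩ h).le
  have hmem := mem_annulusDualCrossing_of_path Φ.hδ (ω := ω ∪ Φ.revealed (Φ.explored ω))
    (Φ.G x') (r := 4 * ρ₀ - 2 * Φ.δ) (R := Rs + 2 * Φ.δ) (γ := W) hWc ?_ ?_ ?_ ?_
    (by linarith [Φ.hδ.le])
  · have e1 : 4 * ρ₀ - 2 * Φ.δ + 2 * Φ.δ = 4 * ρ₀ := by ring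
    have e2 : Rs + 2 * Φ.δ - 2 * Φ.δ = Rs := by ring
    rw [e1, e2] at hmem
    exact hmem
  · -- unrevealed
    intro u hu
    have hsu := hparam u hu
    have hsuI := hparamI u hu
    exact not_mem_openEdgeUnion_union_revealed_of_aligned hAl hAl' hβR hβO hbefore hsuI
      (hsu.2.trans_lt ht₃tg)
  · -- starts within `4ρ₀ - 2δ`
    have : W 0 = Φ.G (β t₃) := by simp [hW]
    rw [this]
    change g t₃ ≤ _
    rw [hgt₃]; linarith
  · intro u hu
    exact (hgbound _ (hparam u hu)).2
  · have : W 1 = Φ.G (β se) := by simp [hW]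
    rw [this]
    exact hgse.ge

/-- The far-from-the-top condition as a predicate of the explored region alone. [folklore] -/
def FarTop (Rs : ℝ) (Λ₀ : Set ℂ) : Prop :=
  ∀ u ∈ Φ.wideRect, u.im = Φ.d → Rs + 2 * Φ.δ < dist (Φ.G u) (Φ.armCentre Λ₀)

/-- `FarTop` at `Λ(ω)` is the condition on `x(ω) = G(wallPt ω)`. [folklore] -/
theorem farTop_explored_iff (Rs : ℝ) (ω : BondConfig (Site 2)) :
    Φ.FarTop Rs (Φ.explored ω) ↔
      ∀ u ∈ Φ.wideRect, u.im = Φ.d → Rs + 2 * Φ.δ < dist (Φ.G u) (Φ.G (Φ.wallPt ω)) := by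
  simp only [FarTop, Φ.armCentre_explored]

/-- **The one-sided estimate for aligned quads, lower half**:
`P_{1/2}(G(R') crossed, G(R) not crossed, x far from the top side) ≤ ε` for any common bound `ε` of
the probabilities of closed dual crossings of the annuli `A(x; 4ρ₀, R)` — decomposition along the
finitely many values of `Λ`, the fresh arm for `ω ∪ revealed Λ₀`
(`union_revealed_mem_annulusDualCrossing_of_aligned`), independence of events on disjoint edge sets
and "conditioning without conditioning", exactly as in `Frame.measure_inter_le`.
[cite: SchrammSmirnov2011, proof of Lemma 6.1, eq. (6.2)] -/
theorem measure_inter_le_of_aligned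
    (hAl : EdgeAligned Φ.δ (Φ.G '' Φ.wideRect)) (hAl' : EdgeAligned Φ.δ (Φ.G '' Φ.rect))
    {ρ₀ Rs : ℝ} (hδρ : 2 * Φ.δ ≤ ρ₀) (h4 : 4 * ρ₀ ≤ Rs)
    (hmodG : ∀ u ∈ Φ.bigRect Φ.Δ, ∀ v ∈ Φ.bigRect Φ.Δ, dist u v ≤ Φ.Δ → dist (Φ.G u) (Φ.G v) ≤ 2 * ρ₀)
    {ε : ℝ≥0∞}
    (hRSW : ∀ x : ℂ, bondPercolation (zdGraph 2) half (annulusDualCrossing x Φ.δ (4 * ρ₀) Rs) ≤ ε) :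
    bondPercolation (zdGraph 2) half {ω | Φ.Crossed Φ.b ω ∧ ¬ Φ.Crossed (Φ.b + Φ.Δ) ω ∧
      Φ.FarTop Rs (Φ.explored ω)} ≤ ε := by
  set P := bondPercolation (zdGraph 2) half with hP
  set A : Set ℂ → Set (BondConfig (Site 2)) := fun Λ₀ => {ω | Φ.explored ω = Λ₀} with hA
  set F : Set ℂ → Set (BondConfig (Site 2)) := fun Λ₀ =>
    (fun ω : BondConfig (Site 2) => ω ∪ Φ.revealed Λ₀) ⁻¹'
      annulusDualCrossing (Φ.armCentre Λ₀) Φ.δ (4 * ρ₀) Rs with hF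
  have hE : {ω | Φ.Crossed Φ.b ω ∧ ¬ Φ.Crossed (Φ.b + Φ.Δ) ω ∧
      Φ.FarTop Rs (Φ.explored ω)} ⊆ ⋃ Λ₀ ∈ range Φ.explored, A Λ₀ ∩ F Λ₀ := by
    rintro ω ⟨hcr, hncr, hfar⟩
    refine mem_iUnion₂.2 ⟨Φ.explored ω, mem_range_self ω, rfl, ?_⟩
    show ω ∪ Φ.revealed (Φ.explored ω) ∈ annulusDualCrossing (Φ.armCentre (Φ.explored ω)) Φ.δ (4 * ρ₀) Rs
    rw [Φ.armCentre_explored]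
    exact union_revealed_mem_annulusDualCrossing_of_aligned hAl hAl' hδρ h4 hmodG hcr hncr
      ((Φ.farTop_explored_iff Rs ω).1 hfar)
  have hAm : ∀ Λ₀ ∈ range Φ.explored, MeasurableSet (A Λ₀) := fun Λ₀ _ =>
    Φ.measurableSet_explored_eq Λ₀
  have hdisj : (range Φ.explored).PairwiseDisjoint A := by
    intro Λ₀ _ Λ₁ _ hne
    rw [Function.onFun, Set.disjoint_left]
    intro ω h0 h1
    exact hne (h0.symm.trans h1)
  have hFm : ∀ Λ₀, MeasurableSet (F Λ₀) := fun Λ₀ =>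
    (measurableSet_annulusDualCrossing Φ.hδ _ _ _).preimage (measurable_union_const _)
  have hprod : ∀ Λ₀ ∈ range Φ.explored, P (A Λ₀ ∩ F Λ₀) = P (A Λ₀) * P (F Λ₀) := fun Λ₀ _ =>
    bondPercolation_inter_of_disjoint (zdGraph 2) half (S := Φ.revealed Λ₀) (T := (Φ.revealed Λ₀)ᶜ)
      disjoint_compl_right (Φ.determinedBy_explored_eq Λ₀) (determinedBy_preimage_union _ _)
      (Φ.measurableSet_explored_eq Λ₀) (hFm Λ₀)
  have hFle : ∀ Λ₀ ∈ range Φ.explored, P (F Λ₀) ≤ ε := fun Λ₀ _ => by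
    refine (measure_mono fun ω hω => ?_).trans (hRSW (Φ.armCentre Λ₀))
    exact isLowerSet_annulusDualCrossing _ _ _ _ (subset_union_left : ω ⊆ ω ∪ Φ.revealed Λ₀) hω
  calc P {ω | Φ.Crossed Φ.b ω ∧ ¬ Φ.Crossed (Φ.b + Φ.Δ) ω ∧ Φ.FarTop Rs (Φ.explored ω)}
      ≤ ε * P univ := measure_le_mul_univ_of_forall_inter_eq_mul P Φ.finite_range_explored.countable
        hE hAm hdisj hprod hFle
    _ = ε := by rw [measure_univ, mul_one]

end Frame

end SSContinuity

end Literature.Probability.Percolation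

end
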